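import Mathlib
import Literature.Analysis.FunctionSpaces.MeanValuePotentialEstimate
import Literature.Analysis.FunctionSpaces.PlanarRieszKernelBounds
import HarnessLib

/-!
# The planar log-Poincaré inequality for small sets

Analysis/FunctionSpaces theorem file (everything proved).  On the Euclidean plane `ℝ² = EuclideanSpace ℝ (Fin 2)` with Lebesgue
measure: there is an absolute constant `C` such that for every `R > 0`, every `f ∈ C¹(ℝ²)` and every measurable `A ⊆ B_R = B(0,R)`
of positive measure,

  `|⨍_A f − ⨍_{B_R} f|² ≤ C (1 + log(πR²/|A|)) ∫_{B_R} ‖Df‖²`     (`logPoincare_smallSets`, with `C = 64`).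

A corollary of two-dimensional exponential integrability (Gilbarg–Trudinger Thm 7.15 / Lemma 7.16, by Jensen); proved here directly
from the mean-value potential estimate `|f(x) − f_{B}| ≤ (2/π)∫_B ‖Df z‖/‖z−x‖ dz` (`enorm_sub_setAverage_le_potential`, GT Lemma 7.16):
averaging over `x ∈ A` and exchanging integrals, `⨍_A |f − f_B| ≤ (2/(π|A|)) ∫_B ‖Df‖ K_A` with `K_A(z) = ∫_A dx/‖z−x‖`; Cauchy–Schwarz and
`∫_B K_A² = ∫_A∫_A ∫_B dz/(‖z−x‖‖z−x′‖) ≤ 4π ∫_A∫_A (1 + log(4R/‖x−x′‖)) ≤ 4π|A|²(3 + log(4R/r_A))`, `πr_A² = |A|`, by the two-pole bound and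
the exchange lemma of `PlanarRieszKernelBounds`; finally `log(4R/r_A) = log 4 + ½ log(πR²/|A|)`.

Consumer: line `casimir_haul` of crux `PowerGaugeEulerLiouville` (NavierStokesRegularity, stmt-19832), stub H2 `stub_logPoincareSmallSets`
(`LogPoincareSmallSets`, same statement).

[cite: GilbargTrudinger2001, Theorem 7.15 and Lemma 7.16 (§7.8)]
-/

noncomputable section

open MeasureTheory Set Filter Metric Function Module Real
open scoped ENNReal NNReal Topology

namespace Literature.Analysis.FunctionSpaces

section Kernel

/-- Measurability of the Riesz kernel `(z, x) ↦ 1/‖z − x‖` (as an `ℝ≥0∞`-valued function). [cite: GilbargTrudinger2001, Lemma 7.12 (proof)] -/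
theorem measurable_invNorm_kernel :
    Measurable fun p : EuclideanSpace ℝ (Fin 2) × EuclideanSpace ℝ (Fin 2) => ENNReal.ofReal (‖p.1 - p.2‖⁻¹) :=
  ((measurable_fst.sub measurable_snd).norm).inv.ennreal_ofReal

/-- The radius of the disc of area `m`: `π r² = m`. [cite: GilbargTrudinger2001, Lemma 7.12 (proof)] -/
theorem pi_mul_sq_sqrt_div_pi {m : ℝ} (hm : 0 ≤ m) : π * (Real.sqrt (m / π)) ^ 2 = m := by
  rw [Real.sq_sqrt (div_nonneg hm pi_pos.le)]
  field_simp

/-- **ROW BOUND**: for `x ∈ A ⊆ B(0,R)`, `|A| = m > 0`, `πr² = m`: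
`∫_{x′∈A} ∫_{B(0,R)} dz/(‖z−x‖‖z−x′‖) ≤ 4π m (3 + log(4R/r))`. [cite: GilbargTrudinger2001, Lemma 7.12 (proof)] -/
theorem lintegral_row_twoPole_le {R : ℝ} {A : Set (EuclideanSpace ℝ (Fin 2))} (hA : MeasurableSet A)
    (hAB : A ⊆ ball (0 : EuclideanSpace ℝ (Fin 2)) R) (hA0 : 0 < volume A) {x : EuclideanSpace ℝ (Fin 2)} (hx : x ∈ A) :
    ∫⁻ x' in A, (∫⁻ z in ball (0 : EuclideanSpace ℝ (Fin 2)) R, ENNReal.ofReal ((‖z - x‖ * ‖z - x'‖)⁻¹)) ≤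
      ENNReal.ofReal (4 * π * (volume A).toReal *
        (3 + Real.log (4 * R / Real.sqrt ((volume A).toReal / π)))) := by
  set m : ℝ := (volume A).toReal with hmdef
  set r : ℝ := Real.sqrt (m / π) with hrdef
  have hxB : x ∈ ball (0 : EuclideanSpace ℝ (Fin 2)) R := hAB hx
  have hR : 0 < R := lt_of_le_of_lt dist_nonneg (mem_ball.1 hxB)
  have hAfin : volume A ≠ ⊤ := ((measure_mono hAB).trans_lt measure_ball_lt_top).ne
  have hm : 0 < m := ENNReal.toReal_pos hA0.ne' hAfin
  have hmA : ENNReal.ofReal m = volume A := ENNReal.ofReal_toReal hAfin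
  have hmle : m ≤ π * R ^ 2 := by
    have h := measure_mono (μ := (volume : Measure (EuclideanSpace ℝ (Fin 2)))) hAB
    rw [EuclideanSpace.volume_ball_fin_two, ← ENNReal.ofReal_pow hR.le, ← ENNReal.ofReal_mul (by positivity)] at h
    rw [hmdef, ← ENNReal.ofReal_le_ofReal_iff (by positivity), ENNReal.ofReal_toReal hAfin]
    calc volume A ≤ ENNReal.ofReal (R ^ 2 * π) := h
      _ = ENNReal.ofReal (π * R ^ 2) := by rw [mul_comm]
  have hr : 0 < r := Real.sqrt_pos.2 (div_pos hm pi_pos)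
  have hrsq : π * r ^ 2 = m := pi_mul_sq_sqrt_div_pi hm.le
  have hrR : r ≤ R := by
    rw [hrdef, ← Real.sqrt_sq hR.le]
    exact Real.sqrt_le_sqrt (by rw [div_le_iff₀ pi_pos]; linarith [hmle])
  have hr4R : r ≤ 4 * R := by linarith
  -- ### a.e. `x′ ≠ x`, and the two-pole bound pointwise
  have hne : ∀ᵐ x' ∂(volume : Measure (EuclideanSpace ℝ (Fin 2))), x' ≠ x := by
    rw [ae_iff]
    have e : {a : EuclideanSpace ℝ (Fin 2) | ¬a ≠ x} = {x} := by ext a; simp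
    rw [e, measure_singleton]
  have hlog_nn : ∀ x' ∈ A, 0 ≤ Real.log (4 * R / ‖x' - x‖) := by
    intro x' hx'
    rcases eq_or_lt_of_le (norm_nonneg (x' - x)) with h0 | h0
    · rw [← h0, div_zero, Real.log_zero]
    · refine Real.log_nonneg ((one_le_div h0).2 ?_)
      have h1 : ‖x' - x‖ < 2 * R := by
        calc ‖x' - x‖ = dist x' x := (dist_eq_norm _ _).symm
          _ ≤ dist x' 0 + dist x 0 := dist_triangle_right _ _ _
          _ < R + R := add_lt_add (mem_ball.1 (hAB hx')) (mem_ball.1 hxB)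
          _ = 2 * R := by ring
      linarith
  have hpt : ∀ᵐ x' ∂(volume.restrict A), (∫⁻ z in ball (0 : EuclideanSpace ℝ (Fin 2)) R, ENNReal.ofReal ((‖z - x‖ * ‖z - x'‖)⁻¹)) ≤
      ENNReal.ofReal (4 * π) + ENNReal.ofReal (4 * π) * ENNReal.ofReal (Real.log (4 * R / ‖x' - x‖)) := by
    filter_upwards [ae_restrict_mem hA, ae_restrict_of_ae hne] with x' hx'A hx'ne
    have h := lintegral_ball_inv_norm_mul_inv_norm_le (c := (0 : EuclideanSpace ℝ (Fin 2))) hxB (hAB hx'A) hx'ne.symm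
    refine h.trans (le_of_eq ?_)
    rw [norm_sub_rev x x', ← ENNReal.ofReal_mul (by positivity), ← ENNReal.ofReal_add (by positivity)
      (mul_nonneg (by positivity) (hlog_nn x' hx'A))]
    ring_nf
  -- ### the exchange: `∫_A log(4R/‖x′−x‖) ≤ ∫_{B(x,r)} log(4R/‖x′−x‖) ≤ πr²(log(4R/r)+2)`
  have hexch : ∫⁻ x' in A, ENNReal.ofReal (Real.log (4 * R / ‖x' - x‖)) ≤
      ENNReal.ofReal (π * r ^ 2 * (Real.log (4 * R / r) + 2)) := by
    have hBm : MeasurableSet (ball x r \ {x}) := measurableSet_ball.diff (measurableSet_singleton x)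
    have hvolB : volume (ball x r \ {x}) = volume A := by
      rw [measure_sdiff_null (measure_singleton x), EuclideanSpace.volume_ball_fin_two, ← ENNReal.ofReal_pow hr.le,
        ← ENNReal.ofReal_mul (by positivity), mul_comm, hrsq, hmA]
    have hge : ∀ z ∈ ball x r \ {x}, ENNReal.ofReal (Real.log (4 * R / r)) ≤ ENNReal.ofReal (Real.log (4 * R / ‖z - x‖)) := by
      intro z hz
      have hz0 : 0 < ‖z - x‖ := norm_pos_iff.2 (sub_ne_zero.2 hz.2)
      have hzr : ‖z - x‖ < r := by rw [← dist_eq_norm]; exact mem_ball.1 hz.1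
      refine ENNReal.ofReal_le_ofReal (Real.log_le_log (by positivity) ?_)
      exact div_le_div_of_nonneg_left (by positivity) hz0 hzr.le
    have hle : ∀ z, z ∉ ball x r \ {x} → ENNReal.ofReal (Real.log (4 * R / ‖z - x‖)) ≤ ENNReal.ofReal (Real.log (4 * R / r)) := by
      intro z hz
      rw [Set.mem_sdiff, not_and, not_not, mem_singleton_iff] at hz
      by_cases hzx : z = x
      · rw [hzx, sub_self, norm_zero, div_zero, Real.log_zero, ENNReal.ofReal_zero]
        exact bot_le
      · have hzr : r ≤ ‖z - x‖ := by
          by_contra hlt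
          exact hzx (hz (by rw [mem_ball, dist_eq_norm]; exact lt_of_not_ge hlt))
        refine ENNReal.ofReal_le_ofReal (Real.log_le_log (div_pos (by positivity) (hr.trans_le hzr)) ?_)
        exact div_le_div_of_nonneg_left (by positivity) hr hzr
    calc ∫⁻ x' in A, ENNReal.ofReal (Real.log (4 * R / ‖x' - x‖))
        ≤ ∫⁻ x' in ball x r \ {x}, ENNReal.ofReal (Real.log (4 * R / ‖x' - x‖)) :=
          setLIntegral_le_of_level hA hBm hvolB.symm hAfin hge hle
      _ ≤ ∫⁻ x' in ball x r, ENNReal.ofReal (Real.log (4 * R / ‖x' - x‖)) := lintegral_mono_set sdiff_subset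
      _ ≤ ENNReal.ofReal (π * r ^ 2 * (Real.log (4 * R / r) + 2)) := lintegral_ball_log_le hr hR hr4R x
  -- ### assemble
  calc ∫⁻ x' in A, (∫⁻ z in ball (0 : EuclideanSpace ℝ (Fin 2)) R, ENNReal.ofReal ((‖z - x‖ * ‖z - x'‖)⁻¹))
      ≤ ∫⁻ x' in A, (ENNReal.ofReal (4 * π) + ENNReal.ofReal (4 * π) * ENNReal.ofReal (Real.log (4 * R / ‖x' - x‖))) :=
        lintegral_mono_ae hpt
    _ = ENNReal.ofReal (4 * π) * volume A + ENNReal.ofReal (4 * π) * ∫⁻ x' in A, ENNReal.ofReal (Real.log (4 * R / ‖x' - x‖)) := by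
        rw [lintegral_add_left measurable_const, setLIntegral_const, lintegral_const_mul' _ _ ENNReal.ofReal_ne_top]
    _ ≤ ENNReal.ofReal (4 * π) * ENNReal.ofReal m + ENNReal.ofReal (4 * π) * ENNReal.ofReal (π * r ^ 2 * (Real.log (4 * R / r) + 2)) := by
        rw [hmA]; gcongr
    _ = ENNReal.ofReal (4 * π * m * (3 + Real.log (4 * R / r))) := by
        rw [← ENNReal.ofReal_mul (by positivity), ← ENNReal.ofReal_mul (by positivity), ← ENNReal.ofReal_add (by positivity)]
        · congr 1
          rw [hrsq]
          ring
        · have : 0 ≤ Real.log (4 * R / r) := Real.log_nonneg ((one_le_div hr).2 hr4R)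
          positivity

/-- **THE SQUARE-INTEGRAL OF THE POTENTIAL OF A SET**: with `K_A(z) = ∫_A dx/‖z − x‖`, `|A| = m`, `πr² = m`, `A ⊆ B(0,R)`:
`∫_{B(0,R)} K_A² ≤ 4π m² (3 + log(4R/r))`. [cite: GilbargTrudinger2001, Lemma 7.12 (proof)] -/
theorem lintegral_ball_sq_setPotential_le {R : ℝ} {A : Set (EuclideanSpace ℝ (Fin 2))} (hA : MeasurableSet A)
    (hAB : A ⊆ ball (0 : EuclideanSpace ℝ (Fin 2)) R) (hA0 : 0 < volume A) :
    ∫⁻ z in ball (0 : EuclideanSpace ℝ (Fin 2)) R, (∫⁻ x in A, ENNReal.ofReal (‖z - x‖⁻¹)) ^ 2 ≤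
      ENNReal.ofReal (4 * π * (volume A).toReal ^ 2 *
        (3 + Real.log (4 * R / Real.sqrt ((volume A).toReal / π)))) := by
  set m : ℝ := (volume A).toReal with hmdef
  have hAfin : volume A ≠ ⊤ := ((measure_mono hAB).trans_lt measure_ball_lt_top).ne
  have hmA : ENNReal.ofReal m = volume A := ENNReal.ofReal_toReal hAfin
  -- the kernel and its measurability
  obtain ⟨k, hk⟩ : ∃ k : EuclideanSpace ℝ (Fin 2) → EuclideanSpace ℝ (Fin 2) → ℝ≥0∞, k = fun z x => ENNReal.ofReal (‖z - x‖⁻¹) :=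
    ⟨_, rfl⟩
  have hkm : Measurable (uncurry k) := by rw [hk]; exact measurable_invNorm_kernel
  have hkz : ∀ z, Measurable (k z) := fun z => hkm.comp measurable_prodMk_left
  set μA : Measure (EuclideanSpace ℝ (Fin 2)) := volume.restrict A with hμA
  set μB : Measure (EuclideanSpace ℝ (Fin 2)) := volume.restrict (ball (0 : EuclideanSpace ℝ (Fin 2)) R) with hμB
  -- the square as a double integral, then as an integral over `A × A`
  have hsq : ∀ z, (∫⁻ x, k z x ∂μA) ^ 2 = ∫⁻ p, k z p.1 * k z p.2 ∂(μA.prod μA) := by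
    intro z
    rw [sq, ← lintegral_lintegral_mul (hkz z).aemeasurable (hkz z).aemeasurable,
      lintegral_prod _ ?_]
    exact ((hkz z).comp measurable_fst).mul ((hkz z).comp measurable_snd) |>.aemeasurable
  have hF : Measurable (uncurry fun (z : EuclideanSpace ℝ (Fin 2)) (p : EuclideanSpace ℝ (Fin 2) × EuclideanSpace ℝ (Fin 2)) =>
      k z p.1 * k z p.2) := by
    have h1 : Measurable fun q : EuclideanSpace ℝ (Fin 2) × (EuclideanSpace ℝ (Fin 2) × EuclideanSpace ℝ (Fin 2)) => k q.1 q.2.1 :=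
      hkm.comp (measurable_fst.prodMk (measurable_fst.comp measurable_snd))
    have h2 : Measurable fun q : EuclideanSpace ℝ (Fin 2) × (EuclideanSpace ℝ (Fin 2) × EuclideanSpace ℝ (Fin 2)) => k q.1 q.2.2 :=
      hkm.comp (measurable_fst.prodMk (measurable_snd.comp measurable_snd))
    exact h1.mul h2
  -- the `z`-integral of the product kernel is the two-pole integral
  have hinner : ∀ p : EuclideanSpace ℝ (Fin 2) × EuclideanSpace ℝ (Fin 2),
      ∫⁻ z, k z p.1 * k z p.2 ∂μB = ∫⁻ z in ball (0 : EuclideanSpace ℝ (Fin 2)) R, ENNReal.ofReal ((‖z - p.1‖ * ‖z - p.2‖)⁻¹) := by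
    intro p
    refine lintegral_congr fun z => ?_
    rw [hk]
    dsimp only
    rw [← ENNReal.ofReal_mul (inv_nonneg.2 (norm_nonneg _)), mul_inv]
  -- sign of the constant
  have hC0 : 0 ≤ 4 * π * m * (3 + Real.log (4 * R / Real.sqrt (m / π))) := by
    obtain ⟨x, hx⟩ : A.Nonempty := nonempty_of_measure_ne_zero hA0.ne'
    have hxB := hAB hx
    have hR : 0 < R := lt_of_le_of_lt dist_nonneg (mem_ball.1 hxB)
    have hm : 0 < m := ENNReal.toReal_pos hA0.ne' hAfin
    have hmle : m ≤ π * R ^ 2 := by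
      have h := measure_mono (μ := (volume : Measure (EuclideanSpace ℝ (Fin 2)))) hAB
      rw [EuclideanSpace.volume_ball_fin_two, ← ENNReal.ofReal_pow hR.le, ← ENNReal.ofReal_mul (by positivity)] at h
      rw [hmdef, ← ENNReal.ofReal_le_ofReal_iff (by positivity), ENNReal.ofReal_toReal hAfin]
      calc volume A ≤ ENNReal.ofReal (R ^ 2 * π) := h
        _ = ENNReal.ofReal (π * R ^ 2) := by rw [mul_comm]
    have hr : 0 < Real.sqrt (m / π) := Real.sqrt_pos.2 (div_pos hm pi_pos)
    have hrR : Real.sqrt (m / π) ≤ R := by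
      rw [← Real.sqrt_sq hR.le]
      exact Real.sqrt_le_sqrt (by rw [div_le_iff₀ pi_pos]; linarith [hmle])
    have hlog : 0 ≤ Real.log (4 * R / Real.sqrt (m / π)) := Real.log_nonneg ((one_le_div hr).2 (by linarith))
    positivity
  -- the row bound, integrated
  have hrow : ∀ x ∈ A, ∫⁻ x', (∫⁻ z, k z x * k z x' ∂μB) ∂μA ≤
      ENNReal.ofReal (4 * π * m * (3 + Real.log (4 * R / Real.sqrt (m / π)))) := by
    intro x hx
    have h := lintegral_row_twoPole_le hA hAB hA0 hx
    refine le_trans (le_of_eq (lintegral_congr fun x' => hinner (x, x'))) h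
  calc ∫⁻ z in ball (0 : EuclideanSpace ℝ (Fin 2)) R, (∫⁻ x in A, ENNReal.ofReal (‖z - x‖⁻¹)) ^ 2
      = ∫⁻ z, (∫⁻ x, k z x ∂μA) ^ 2 ∂μB := by rw [hk]
    _ = ∫⁻ z, ∫⁻ p, k z p.1 * k z p.2 ∂(μA.prod μA) ∂μB := lintegral_congr fun z => hsq z
    _ = ∫⁻ p, ∫⁻ z, k z p.1 * k z p.2 ∂μB ∂(μA.prod μA) := lintegral_lintegral_swap hF.aemeasurable
    _ = ∫⁻ x, ∫⁻ x', ∫⁻ z, k z x * k z x' ∂μB ∂μA ∂μA :=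
        lintegral_prod _ (Measurable.lintegral_prod_right' (hF.comp measurable_swap)).aemeasurable
    _ ≤ ∫⁻ x, ENNReal.ofReal (4 * π * m * (3 + Real.log (4 * R / Real.sqrt (m / π)))) ∂μA :=
        setLIntegral_mono' hA fun x hx => hrow x hx
    _ = ENNReal.ofReal (4 * π * m * (3 + Real.log (4 * R / Real.sqrt (m / π)))) * volume A := setLIntegral_const _ _
    _ = ENNReal.ofReal (4 * π * m ^ 2 * (3 + Real.log (4 * R / Real.sqrt (m / π)))) := by
        rw [← hmA, ← ENNReal.ofReal_mul hC0]
        congr 1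
        ring

end Kernel

section Main

/-- `log(4R / r) = log 4 + ½ log(πR²/m)` for `πr² = m`. [cite: GilbargTrudinger2001, Lemma 7.12 (proof)] -/
theorem log_div_sqrt_eq {R m : ℝ} (hR : 0 < R) (hm : 0 < m) :
    Real.log (4 * R / Real.sqrt (m / π)) = Real.log 4 + Real.log (π * R ^ 2 / m) / 2 := by
  have hs : 0 < Real.sqrt (m / π) := Real.sqrt_pos.2 (div_pos hm pi_pos)
  have e1 : 4 * R / Real.sqrt (m / π) = 4 * Real.sqrt (π * R ^ 2 / m) := by
    rw [show π * R ^ 2 / m = (m / π)⁻¹ * R ^ 2 by field_simp, Real.sqrt_mul (inv_nonneg.2 (div_nonneg hm.le pi_pos.le)),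
      Real.sqrt_inv, Real.sqrt_sq hR.le]
    field_simp
  rw [e1, Real.log_mul (by norm_num) (Real.sqrt_pos.2 (by positivity)).ne', Real.log_sqrt (by positivity)]

/-- The numerical constant: `(16/π)(3 + log 4 + L/2) ≤ 64 (1 + L)` for `L ≥ 0`. [cite: GilbargTrudinger2001, Theorem 7.15 (constants)] -/
theorem const_bound {L : ℝ} (hL : 0 ≤ L) : 16 / π * (3 + Real.log 4 + L / 2) ≤ 64 * (1 + L) := by
  have hπ : 3 < π := Real.pi_gt_three
  have hlog : Real.log 4 ≤ 3 := by
    have h := Real.log_le_sub_one_of_pos (show (0 : ℝ) < 4 by norm_num)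
    linarith
  have h16 : 16 / π ≤ 6 := by rw [div_le_iff₀ pi_pos]; linarith
  have h2 : 0 ≤ 3 + Real.log 4 + L / 2 := by
    have : 0 ≤ Real.log 4 := Real.log_nonneg (by norm_num)
    positivity
  calc 16 / π * (3 + Real.log 4 + L / 2) ≤ 6 * (3 + Real.log 4 + L / 2) := mul_le_mul_of_nonneg_right h16 h2
    _ ≤ 64 * (1 + L) := by nlinarith

/-- **THE PLANAR LOG-POINCARÉ INEQUALITY FOR SMALL SETS.**  There is `C > 0` (`C = 64`) such that for every `R > 0`, every
`f ∈ C¹(ℝ²)` and every measurable `A ⊆ B(0,R)` of positive measure,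
`|⨍_A f − ⨍_{B(0,R)} f|² ≤ C (1 + log(πR²/|A|)) ∫_{B(0,R)} ‖Df‖²`.
[cite: GilbargTrudinger2001, Theorem 7.15 and Lemma 7.16] -/
theorem logPoincare_smallSets :
    ∃ C : ℝ, 0 < C ∧ ∀ R : ℝ, 0 < R → ∀ f : EuclideanSpace ℝ (Fin 2) → ℝ, ContDiff ℝ 1 f →
      ∀ A : Set (EuclideanSpace ℝ (Fin 2)), MeasurableSet A → A ⊆ Metric.ball (0 : EuclideanSpace ℝ (Fin 2)) R → 0 < volume A →
        |(⨍ x in A, f x) - ⨍ x in Metric.ball (0 : EuclideanSpace ℝ (Fin 2)) R, f x| ^ 2 ≤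
          C * (1 + Real.log (Real.pi * R ^ 2 / (volume A).toReal)) *
            ∫ x in Metric.ball (0 : EuclideanSpace ℝ (Fin 2)) R, ‖fderiv ℝ f x‖ ^ 2 := by
  refine ⟨64, by norm_num, fun R hR f hf A hA hAB hA0 => ?_⟩
  -- ### names and basic facts
  set m : ℝ := (volume A).toReal with hmdef
  set L : ℝ := Real.log (π * R ^ 2 / m) with hLdef
  set fB : ℝ := ⨍ x in (ball (0 : EuclideanSpace ℝ (Fin 2)) R), f x with hfBdef
  set I : ℝ := ∫ x in (ball (0 : EuclideanSpace ℝ (Fin 2)) R), ‖fderiv ℝ f x‖ ^ 2 with hIdef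
  have hAfin : volume A ≠ ⊤ := ((measure_mono hAB).trans_lt measure_ball_lt_top).ne
  have hm : 0 < m := ENNReal.toReal_pos hA0.ne' hAfin
  have hmA : ENNReal.ofReal m = volume A := ENNReal.ofReal_toReal hAfin
  have hBvol : volume (ball (0 : EuclideanSpace ℝ (Fin 2)) R) = ENNReal.ofReal (π * R ^ 2) := by
    rw [EuclideanSpace.volume_ball_fin_two, ← ENNReal.ofReal_pow hR.le, ← ENNReal.ofReal_mul (by positivity), mul_comm]
  have hB0 : volume (ball (0 : EuclideanSpace ℝ (Fin 2)) R) ≠ 0 := by rw [hBvol]; exact (ENNReal.ofReal_pos.2 (by positivity)).ne'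
  have hmle : m ≤ π * R ^ 2 := by
    have h := measure_mono (μ := (volume : Measure (EuclideanSpace ℝ (Fin 2)))) hAB
    rw [hBvol] at h
    rwa [hmdef, ← ENNReal.ofReal_le_ofReal_iff (by positivity), ENNReal.ofReal_toReal hAfin]
  have hL : 0 ≤ L := Real.log_nonneg ((one_le_div hm).2 hmle)
  have hDfc : Continuous (fderiv ℝ f) := hf.continuous_fderiv one_ne_zero
  have hn2 : finrank ℝ (EuclideanSpace ℝ (Fin 2)) = 2 := by simp
  -- ### Step 1: the potential bound at every `x ∈ (ball (0 : EuclideanSpace ℝ (Fin 2)) R)`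
  have hP : ∀ x ∈ (ball (0 : EuclideanSpace ℝ (Fin 2)) R), ‖f x - fB‖ₑ ≤ ENNReal.ofReal (2 / π) *
      ∫⁻ z in (ball (0 : EuclideanSpace ℝ (Fin 2)) R), ‖fderiv ℝ f z‖ₑ * ENNReal.ofReal (‖z - x‖⁻¹) := by
    intro x hx
    have h := enorm_sub_setAverage_le_potential (volume : Measure (EuclideanSpace ℝ (Fin 2))) (by rw [hn2]; norm_num) hf
      measurableSet_ball (subset_refl (ball (0 : EuclideanSpace ℝ (Fin 2)) R)) hB0 hx
    rw [hn2] at h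
    simp only [Nat.add_one_sub_one, pow_one, Nat.cast_ofNat] at h
    refine h.trans (le_of_eq ?_)
    congr 1
    rw [hBvol, ← ENNReal.ofReal_div_of_pos (by positivity)]
    congr 1
    field_simp
  -- ### Step 2: averaging over `A`
  have hfiA : IntegrableOn f A volume :=
    (hf.continuous.continuousOn.integrableOn_compact (isCompact_closedBall (0 : EuclideanSpace ℝ (Fin 2)) R)).mono_set
      (hAB.trans ball_subset_closedBall)
  have hS2 : ‖(⨍ x in A, f x) - fB‖ₑ ≤ (volume A)⁻¹ * (ENNReal.ofReal (2 / π) *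
      ∫⁻ x in A, (∫⁻ z in (ball (0 : EuclideanSpace ℝ (Fin 2)) R), ‖fderiv ℝ f z‖ₑ * ENNReal.ofReal (‖z - x‖⁻¹))) := by
    have h := enorm_sub_setAverage_le hA0.ne' hAfin hfiA fB
    rw [enorm_sub_rev] at h
    refine h.trans ?_
    gcongr
    rw [← lintegral_const_mul' _ _ ENNReal.ofReal_ne_top]
    refine setLIntegral_mono' hA fun x hx => ?_
    rw [enorm_sub_rev]
    exact hP x (hAB hx)
  -- ### Step 3: Tonelli — `∫_A ∫_B ‖Df z‖/‖z−x‖ = ∫_B ‖Df z‖ K_A(z)`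
  obtain ⟨K, hK⟩ : ∃ K : EuclideanSpace ℝ (Fin 2) → ℝ≥0∞, K = fun z => ∫⁻ x in A, ENNReal.ofReal (‖z - x‖⁻¹) := ⟨_, rfl⟩
  have hgm : Measurable fun z : EuclideanSpace ℝ (Fin 2) => ‖fderiv ℝ f z‖ₑ := hDfc.measurable.enorm
  have hKm : Measurable K := by
    have h := Measurable.lintegral_prod_right' (ν := volume.restrict A)
      (f := fun p : EuclideanSpace ℝ (Fin 2) × EuclideanSpace ℝ (Fin 2) => ENNReal.ofReal (‖p.1 - p.2‖⁻¹)) measurable_invNorm_kernel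
    dsimp only at h
    rw [hK]
    exact h
  have hT : ∫⁻ x in A, (∫⁻ z in (ball (0 : EuclideanSpace ℝ (Fin 2)) R), ‖fderiv ℝ f z‖ₑ * ENNReal.ofReal (‖z - x‖⁻¹)) = ∫⁻ z in (ball (0 : EuclideanSpace ℝ (Fin 2)) R), ‖fderiv ℝ f z‖ₑ * K z := by
    have hm2 : Measurable fun p : EuclideanSpace ℝ (Fin 2) × EuclideanSpace ℝ (Fin 2) =>
        ‖fderiv ℝ f p.2‖ₑ * ENNReal.ofReal (‖p.2 - p.1‖⁻¹) :=
      (hgm.comp measurable_snd).mul ((measurable_snd.sub measurable_fst).norm.inv.ennreal_ofReal)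
    have hswap : ∫⁻ x in A, (∫⁻ z in (ball (0 : EuclideanSpace ℝ (Fin 2)) R), ‖fderiv ℝ f z‖ₑ * ENNReal.ofReal (‖z - x‖⁻¹)) =
        ∫⁻ z in (ball (0 : EuclideanSpace ℝ (Fin 2)) R), (∫⁻ x in A, ‖fderiv ℝ f z‖ₑ * ENNReal.ofReal (‖z - x‖⁻¹)) :=
      lintegral_lintegral_swap (by exact hm2.aemeasurable)
    rw [hswap]
    refine lintegral_congr fun z => ?_
    have hkz : Measurable fun x : EuclideanSpace ℝ (Fin 2) => ENNReal.ofReal (‖z - x‖⁻¹) :=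
      ((measurable_const.sub measurable_id).norm).inv.ennreal_ofReal
    rw [hK]
    exact lintegral_const_mul _ hkz
  -- ### Step 4: Cauchy–Schwarz
  have hCS : ∫⁻ z in (ball (0 : EuclideanSpace ℝ (Fin 2)) R), ‖fderiv ℝ f z‖ₑ * K z ≤
      (∫⁻ z in (ball (0 : EuclideanSpace ℝ (Fin 2)) R), ‖fderiv ℝ f z‖ₑ ^ (2 : ℝ)) ^ (1 / (2 : ℝ)) * (∫⁻ z in (ball (0 : EuclideanSpace ℝ (Fin 2)) R), K z ^ (2 : ℝ)) ^ (1 / (2 : ℝ)) := by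
    have h := ENNReal.lintegral_mul_le_Lp_mul_Lq (volume.restrict (ball (0 : EuclideanSpace ℝ (Fin 2)) R)) Real.HolderConjugate.two_two hgm.aemeasurable hKm.aemeasurable
    simpa only [Pi.mul_apply] using h
  -- ### Step 5: the two factors
  have hIint : IntegrableOn (fun x => ‖fderiv ℝ f x‖ ^ 2) (ball (0 : EuclideanSpace ℝ (Fin 2)) R) volume :=
    ((hDfc.norm.pow 2).continuousOn.integrableOn_compact (isCompact_closedBall (0 : EuclideanSpace ℝ (Fin 2)) R)).mono_set
      ball_subset_closedBall
  have hI0 : 0 ≤ I := setIntegral_nonneg measurableSet_ball fun x _ => by positivity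
  have hX : ∫⁻ z in (ball (0 : EuclideanSpace ℝ (Fin 2)) R), ‖fderiv ℝ f z‖ₑ ^ (2 : ℝ) = ENNReal.ofReal I := by
    rw [hIdef, ofReal_integral_eq_lintegral_ofReal hIint (ae_of_all _ fun x => by positivity)]
    refine lintegral_congr fun z => ?_
    rw [ENNReal.rpow_two, ← ofReal_norm, ← ENNReal.ofReal_pow (norm_nonneg _)]
  obtain ⟨T, hTdef⟩ : ∃ T : ℝ, T = 3 + Real.log (4 * R / Real.sqrt (m / π)) := ⟨_, rfl⟩
  have hTeq : T = 3 + Real.log 4 + L / 2 := by rw [hTdef, log_div_sqrt_eq hR hm, hLdef]; ring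
  have hT0 : 0 ≤ T := by
    have : 0 ≤ Real.log 4 := Real.log_nonneg (by norm_num)
    rw [hTeq]; positivity
  have hY : ∫⁻ z in (ball (0 : EuclideanSpace ℝ (Fin 2)) R), K z ^ (2 : ℝ) ≤ ENNReal.ofReal (4 * π * m ^ 2 * T) := by
    have h := lintegral_ball_sq_setPotential_le (R := R) hA hAB hA0
    rw [hTdef]
    simp_rw [ENNReal.rpow_two, hK]
    exact h
  -- ### Step 6: assembly in `ℝ≥0∞`, then back to `ℝ`
  obtain ⟨Q, hQdef⟩ : ∃ Q : ℝ, Q = m⁻¹ * (2 / π) * (Real.sqrt I * Real.sqrt (4 * π * m ^ 2 * T)) := ⟨_, rfl⟩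
  have hQ0 : 0 ≤ Q := by rw [hQdef]; positivity
  have hE : ‖(⨍ x in A, f x) - fB‖ₑ ≤ ENNReal.ofReal Q := by
    calc ‖(⨍ x in A, f x) - fB‖ₑ
        ≤ (volume A)⁻¹ * (ENNReal.ofReal (2 / π) * ∫⁻ z in (ball (0 : EuclideanSpace ℝ (Fin 2)) R), ‖fderiv ℝ f z‖ₑ * K z) := by rw [← hT]; exact hS2
      _ ≤ (volume A)⁻¹ * (ENNReal.ofReal (2 / π) *
            ((ENNReal.ofReal I) ^ (1 / (2 : ℝ)) * (ENNReal.ofReal (4 * π * m ^ 2 * T)) ^ (1 / (2 : ℝ)))) := by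
          gcongr
          calc ∫⁻ z in (ball (0 : EuclideanSpace ℝ (Fin 2)) R), ‖fderiv ℝ f z‖ₑ * K z
              ≤ (∫⁻ z in (ball (0 : EuclideanSpace ℝ (Fin 2)) R), ‖fderiv ℝ f z‖ₑ ^ (2 : ℝ)) ^ (1 / (2 : ℝ)) * (∫⁻ z in (ball (0 : EuclideanSpace ℝ (Fin 2)) R), K z ^ (2 : ℝ)) ^ (1 / (2 : ℝ)) := hCS
            _ ≤ (ENNReal.ofReal I) ^ (1 / (2 : ℝ)) * (ENNReal.ofReal (4 * π * m ^ 2 * T)) ^ (1 / (2 : ℝ)) := by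
                rw [hX]; gcongr
      _ = ENNReal.ofReal Q := by
          rw [← hmA, ← ENNReal.ofReal_inv_of_pos hm, ENNReal.ofReal_rpow_of_nonneg hI0 (by norm_num),
            ENNReal.ofReal_rpow_of_nonneg (by positivity) (by norm_num), ← Real.sqrt_eq_rpow, ← Real.sqrt_eq_rpow,
            ← ENNReal.ofReal_mul (Real.sqrt_nonneg _), ← ENNReal.ofReal_mul (by positivity),
            ← ENNReal.ofReal_mul (inv_nonneg.2 hm.le), hQdef]
          congr 1
          ring
  have hD : |(⨍ x in A, f x) - fB| ≤ Q := by
    rw [Real.enorm_eq_ofReal_abs] at hE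
    exact (ENNReal.ofReal_le_ofReal_iff hQ0).1 hE
  have hQsq : Q ^ 2 = 16 / π * T * I := by
    rw [hQdef, mul_pow, mul_pow, mul_pow, Real.sq_sqrt hI0, Real.sq_sqrt (by positivity)]
    field_simp
    ring
  calc |(⨍ x in A, f x) - fB| ^ 2 ≤ Q ^ 2 := pow_le_pow_left₀ (abs_nonneg _) hD 2
    _ = 16 / π * (3 + Real.log 4 + L / 2) * I := by rw [hQsq, hTeq]
    _ ≤ 64 * (1 + L) * I := mul_le_mul_of_nonneg_right (const_bound hL) hI0

end Main

end Literature.Analysis.FunctionSpaces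

end
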